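import Summits.Ventures.PercRepro.RankLevelSetHallLostFrac

/-!
# PercRepro — THE WEIGHTED LOST-SET RULES: A BIG `Y`-SET SPLITS ITS UNIT AMONG ITS LOST SUBSETS PROPORTIONALLY TO ANY
NON-NEGATIVE WEIGHT `g` (p4, gen 33; C-044, UP form; paper proofs/P4-CELL-THREE.md §14.20 (j))

Rule BIN (RankLevelSetHallLostBin) is the weight `g S = C(#S, q)`.  The closed form on `U ⊕ (k−1)` parallel pairs refutes it
(§14.20 (j): the lost set containing all the pairs receives `0.94` at `(k, q) = (8, 10)`), while the weight
`g S = C(#S, q)·2^{#S − q}` survives every computation.  THIS FILE states the transfer once for EVERY weight: for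
`g : Set α → ℚ` non-negative, a big `Y`-set `T` gives the lost subset `S ⊆ T` the share `g S / G(T)`,
`G(T) = Σ_{S' lost ⊆ T} g S'` (`lostRuleWeight`); the loads are `G(T)/G(T) ≤ 1`, and `LostRule g` (every lost set receives
at least `1` — a `Prop`, NOT asserted for any `g`) gives a fractional lost-set matching, hence the UP-Hall form
(`hallUp_of_ncard_eq_of_lostRule`).  Rule BIN is `g S = C(#S, q)`, the equal split is `g ≡ 1`, and the size weights
`sizeWeight q c S = C(#S, q)·c^{#S − q}` are instantiated (`hallUp_of_ncard_eq_of_sizeRule`); a weight depending on `T` as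
well (the Boolean weight `1/C(#T, #S)`) is a fractional matching in the sense of RankLevelSetHallLostFrac, not a rule here.
* `lostRuleMass`, `lostRuleWeight`, `lostRuleRecv`, `LostRule`;
* `lostRuleWeight_load_le_one`, `lostFrac_of_lostRule`, **`hallUp_of_ncard_eq_of_lostRule`**.
Axioms: standard.
-/

namespace PercRepro

open Set Matroid Finset

variable {α : Type} (M : Matroid α) [M.Finite]

/-- The **`g`-mass of the lost subsets** of `T`: `G(T) = Σ_{S lost, S ⊆ T} g S`. -/
noncomputable def lostRuleMass (p q : ℕ) (g : Set α → ℚ) (T : Set α) : ℚ := by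
  classical
  exact ∑ S ∈ (lostSets_finite M p q).toFinset, (if S ⊆ T then g S else 0)

/-- **The weighted rule's weight** of the pair `(S, T)`: for a lost set `S` inside the big `Y`-set `T`, `g S / G(T)`;
`0` otherwise. -/
noncomputable def lostRuleWeight (p q : ℕ) (g : Set α → ℚ) (S T : Set α) : ℚ := by
  classical
  exact if S ∈ lostSets M p q ∧ T ∈ bigY M p q ∧ S ⊆ T then g S / lostRuleMass M p q g T else 0

/-- What the lost set `S` receives under the weighted rule. -/
noncomputable def lostRuleRecv (p q : ℕ) (g : Set α → ℚ) (S : Set α) : ℚ :=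
  ∑ T ∈ (bigY_finite M p q).toFinset, lostRuleWeight M p q g S T

/-- **The weighted lost-set rule** `g` — a `Prop`, NOT asserted: every lost set receives at least `1`. -/
def LostRule (p q : ℕ) (g : Set α → ℚ) : Prop := ∀ S ∈ lostSets M p q, 1 ≤ lostRuleRecv M p q g S

/-- The `g`-mass is non-negative for a non-negative weight. -/
theorem lostRuleMass_nonneg (p q : ℕ) (g : Set α → ℚ) (hg : ∀ S, 0 ≤ g S) (T : Set α) :
    0 ≤ lostRuleMass M p q g T := by
  classical
  unfold lostRuleMass
  refine Finset.sum_nonneg (fun S _ => ?_)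
  split_ifs
  · exact hg S
  · exact le_rfl

/-- The weights are non-negative. -/
theorem lostRuleWeight_nonneg (p q : ℕ) (g : Set α → ℚ) (hg : ∀ S, 0 ≤ g S) (S T : Set α) :
    0 ≤ lostRuleWeight M p q g S T := by
  classical
  unfold lostRuleWeight
  split_ifs
  · exact div_nonneg (hg S) (lostRuleMass_nonneg M p q g hg T)
  · exact le_rfl

/-- The weights are supported on the pairs of a lost set inside a big `Y`-set. -/
theorem lostRuleWeight_support (p q : ℕ) (g : Set α → ℚ) (S T : Set α) (h : lostRuleWeight M p q g S T ≠ 0) :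
    S ∈ lostSets M p q ∧ T ∈ bigY M p q ∧ S ⊆ T := by
  classical
  unfold lostRuleWeight at h
  by_contra hc
  exact h (if_neg hc)

/-- **Every big `Y`-set is loaded at most `1`**: the load is `G(T) / G(T)`. -/
theorem lostRuleWeight_load_le_one (p q : ℕ) (g : Set α → ℚ) (T : Set α) (hT : T ∈ bigY M p q) :
    ∑ S ∈ (lostSets_finite M p q).toFinset, lostRuleWeight M p q g S T ≤ 1 := by
  classical
  have hw : ∀ S ∈ (lostSets_finite M p q).toFinset, lostRuleWeight M p q g S T
      = (if S ⊆ T then g S else 0) / lostRuleMass M p q g T := by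
    intro S hS
    rw [(lostSets_finite M p q).mem_toFinset] at hS
    unfold lostRuleWeight
    by_cases hST : S ⊆ T
    · rw [if_pos ⟨hS, hT, hST⟩, if_pos hST]
    · rw [if_neg (fun hc => hST hc.2.2), if_neg hST, zero_div]
  rw [Finset.sum_congr rfl hw, ← Finset.sum_div]
  exact div_self_le_one _

/-- **A weighted rule with receipts `≥ 1` is a fractional lost-set matching.** -/
theorem lostFrac_of_lostRule (p q : ℕ) (g : Set α → ℚ) (hg : ∀ S, 0 ≤ g S) (h : LostRule M p q g) :
    LostFrac M p q :=
  ⟨lostRuleWeight M p q g, lostRuleWeight_nonneg M p q g hg, lostRuleWeight_support M p q g, fun S hS => h S hS,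
    fun T hT => lostRuleWeight_load_le_one M p q g T hT⟩

/-- **THE TRANSFER FOR EVERY WEIGHTED LOST-SET RULE**: at the tight layer `#E = p + q` with `q < p`, if every lost set
receives at least `1` under the rule `g ≥ 0`, then every family of members has at least `Φ(p,q)·#𝒜` UP-neighbours. -/
theorem hallUp_of_ncard_eq_of_lostRule (p q : ℕ) (hE : M.E.ncard = p + q) (hpq : q < p) (g : Set α → ℚ)
    (hg : ∀ S, 0 ≤ g S) (h : LostRule M p q g) (𝒜 : Set (Set α)) (h𝒜 : 𝒜 ⊆ cellMembers M p q) :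
    phiK p q * (𝒜.ncard : ℚ) ≤ ((upNbhd M p q 𝒜).ncard : ℚ) :=
  hallUp_of_ncard_eq_of_lostFrac M p q hE hpq (lostFrac_of_lostRule M p q g hg h) 𝒜 h𝒜

/-- **The size weights** `g_c S = C(#S, q)·c^{#S − q}`: `c = 1` is Rule BIN, `c = 2` the corrected rule of record. -/
noncomputable def sizeWeight (q : ℕ) (c : ℚ) (S : Set α) : ℚ := ((S.ncard.choose q : ℕ) : ℚ) * c ^ (S.ncard - q)

omit [M.Finite] in
/-- The size weights are non-negative for `0 ≤ c`. -/
theorem sizeWeight_nonneg (q : ℕ) (c : ℚ) (hc : 0 ≤ c) (S : Set α) : 0 ≤ sizeWeight q c S := by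
  unfold sizeWeight
  positivity

/-- **The UP-Hall form from the size rule `g_c`** (tight layer), for any `0 ≤ c`. -/
theorem hallUp_of_ncard_eq_of_sizeRule (p q : ℕ) (hE : M.E.ncard = p + q) (hpq : q < p) (c : ℚ) (hc : 0 ≤ c)
    (h : LostRule M p q (sizeWeight q c)) (𝒜 : Set (Set α)) (h𝒜 : 𝒜 ⊆ cellMembers M p q) :
    phiK p q * (𝒜.ncard : ℚ) ≤ ((upNbhd M p q 𝒜).ncard : ℚ) :=
  hallUp_of_ncard_eq_of_lostRule M p q hE hpq (sizeWeight q c) (sizeWeight_nonneg q c hc) h 𝒜 h𝒜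

end PercRepro
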